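import Mathlib
import HarnessLib
import Summits.HubbardSuperconductivity.HubbardSuperconductivity.Theorems.KLProgrammeKLRegimeEngineV8DefsG5Reading
import Summits.HubbardSuperconductivity.HubbardSuperconductivity.Theorems.KLProgrammeKLRegimeSplitEngineV10
import Summits.HubbardSuperconductivity.HubbardSuperconductivity.Theorems.KLProgrammeKLRegimeSplitPairLadder

/-!
# Route `KLProgramme` — crux K3, ENGINE child gen 6 (stmt-HubbardSuperconductivity-20236 `KLRegimeEngineV16`, skeleton v2 83c0c5823086011a),
# stub `stub_engine_step_values`: the THERMAL BAND of the value lane — in the last `T` scales of the extended ladder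
# `nScales β − T ≤ n ≤ nScales β + 1` the three value conjuncts (E2-v10) / (E2″-v7) / (E2′-S4) follow from SIGN-BLIND increment bounds
# (cell gate-hubbard-kl, seat hubbard-kl-k3c2-p2 g7, row «thermal-bar induction n ≤ nScales β + 1»)

WHY.  The thermal majorant `thermalBar G P U β n = CF·(Klam U)²·4^{-(n_β − n)}` (`…SplitEngineV4`) is carried by all three value clauses of the
engine slot `EngineBoundsAtV10S` (`…SplitEngineV10`).  Towards the temperature scale it GROWS geometrically to the full unit `CF·(Klam U)²`
(`klth_thermalBar_eq_of_nScales_le`), and at the package of record `klEngGeo5` one has `CF ≥ 2^80` (`two_pow_le_klEngGeo5_CF`).  Hence in the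
band `n_β ≤ n + T` any increment estimate of the plain form `X ≤ C·(Klam U)²` with `C·4^T ≤ CF` is already inside `thermalBar` — no
zero-sound cancellation, no resolvent structure, no transfer resolution is needed there: the discrete Matsubara sums of the band are `O(1)`
objects and the slot was sized for exactly that (DECOMP App. E (T), HOME/hubbard-kl-k3c2-p2/THERMAL-NOTE.md).  This file makes the reading
BY NAME, for the takers of `stub_engine_step_values`:

* §1 `klband_unit_le_thermalBar` (`CF·(Klam U)²·(4^T)⁻¹ ≤ thermalBar … n` in the band), `klband_le_thermalBar` (reading lemma:
  `X ≤ C·(Klam U)²`, `C·4^T ≤ G.CF`, `n_β ≤ n + T` ⇒ `X ≤ thermalBar G P U β n`);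
* §2 G-generic doors (`G.WF`, `P.WF`, `Q.WF` give the signs of the other budget terms): **`klband_pairValueIncrementAtV7_of_le_thermalBar`**,
  **`klband_quarticValueIncrementAtS4_of_le_thermalBar`**, **`klband_pairLadderStepAtV10_of_le_thermalBar`** — the last with the trivial ladder
  witness `w = 0`, `N = 1` (so `A·N = klPairArray … (n−1) Qm`, whose ball entries are `𝒞_{n−1}`): in the band the in-class ladder clause is a plain
  value-increment bound too; `klband_valueClauses_of_le_thermalBar` (the three together);
* §3 the `klEngGeo5` reading: `klg5_band_le_thermalBar` (`C·4^T ≤ 2^80`), and **`klg5_band_stepValues_of_signBlind`** — the literal five-conjunct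
  conclusion of `stub_engine_step_values` at `(klEngGeo5, Q)` from sign-blind increment bounds `‖𝒞_n − 𝒞_{n−1}‖ ≤ Cp·(Klam U)²` (all `Qm`, ball × ball),
  `‖λ_n^{↑↓} − λ_{n−1}^{↑↓}‖ ≤ Cq·(Klam U)²` (ball³) with `Cp·4^T, Cq·4^T ≤ 2^80`, `n_β ≤ n + T`, plus (E4)_n and (E5-S)_n.

Bookkeeping only (order-preserving inequalities on the landed slot texts); nothing about the model is asserted; nothing asserts superconductivity.
-/

noncomputable section

namespace Summit.HubbardSuperconductivity.HubbardSuperconductivity.Theorems.EngineV8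

set_option linter.dupNamespace false -- summit = problem name (single-conjunct summit), D-0017

open Real Finset Literature.MathematicalPhysics.QuantumLattice Literature.Probability.LatticeModels
open Summit.HubbardSuperconductivity.HubbardSuperconductivity.Theorems.KLRegimeSplit
open Summit.HubbardSuperconductivity.HubbardSuperconductivity.Theorems.KLProgrammeLegKernels

/-! ## §1 The band: `thermalBar` dominates a flat second-order unit -/

/-- **In the band `n_β ≤ n + T` the thermal majorant is at least `CF·(Klam U)²·4^{-T}`** (`0 ≤ CF`). -/
theorem klband_unit_le_thermalBar {G : GeoConsts} (hG : 0 ≤ G.CF) (P : SplitConsts) (U β : ℝ) {n T : ℕ}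
    (hband : nScales β ≤ n + T) :
    G.CF * (P.Klam * U) ^ 2 * ((4 : ℝ) ^ T)⁻¹ ≤ thermalBar G P U β n := by
  unfold thermalBar
  refine mul_le_mul_of_nonneg_left ?_ (by positivity)
  exact inv_anti₀ (by positivity) (pow_le_pow_right₀ (by norm_num) (by omega))

/-- **Reading lemma for the band**: `X ≤ C·(Klam U)²` with `0 ≤ C`, `C·4^T ≤ G.CF` and `n_β ≤ n + T` give `X ≤ thermalBar G P U β n`. -/
theorem klband_le_thermalBar {G : GeoConsts} {P : SplitConsts} {U β X C : ℝ} {n T : ℕ} (hC : 0 ≤ C)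
    (hCT : C * 4 ^ T ≤ G.CF) (hband : nScales β ≤ n + T) (hX : X ≤ C * (P.Klam * U) ^ 2) :
    X ≤ thermalBar G P U β n := by
  have h4 : (0 : ℝ) < 4 ^ T := by positivity
  have hG : 0 ≤ G.CF := le_trans (mul_nonneg hC h4.le) hCT
  refine hX.trans (le_trans ?_ (klband_unit_le_thermalBar hG P U β hband))
  have hC' : C ≤ G.CF * ((4 : ℝ) ^ T)⁻¹ := by
    rw [← div_eq_mul_inv, le_div_iff₀ h4]
    exact hCT
  calc C * (P.Klam * U) ^ 2 ≤ G.CF * ((4 : ℝ) ^ T)⁻¹ * (P.Klam * U) ^ 2 := mul_le_mul_of_nonneg_right hC' (sq_nonneg _)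
    _ = G.CF * (P.Klam * U) ^ 2 * ((4 : ℝ) ^ T)⁻¹ := by ring

/-- At and beyond the last scale (`n_β ≤ n`, i.e. `T = 0`): `X ≤ C·(Klam U)²`, `C ≤ CF` ⇒ `X ≤ thermalBar`. -/
theorem klband_le_thermalBar_of_nScales_le {G : GeoConsts} {P : SplitConsts} {U β X C : ℝ} {n : ℕ} (hC : 0 ≤ C)
    (hCF : C ≤ G.CF) (hn : nScales β ≤ n) (hX : X ≤ C * (P.Klam * U) ^ 2) : X ≤ thermalBar G P U β n :=
  klband_le_thermalBar (T := 0) hC (by simpa using hCF) (by simpa using hn) hX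

/-! ## §2 The three value clauses from sign-blind increment bounds inside `thermalBar` (G-generic) -/

section Model

variable {L M : ℕ} [NeZero L] [NeZero M] {G : GeoConsts} {P : SplitConsts} {Q : EngConsts} {β U μ : ℝ} {K : TrigPolyC4v} {n : ℕ}

omit [NeZero L] [NeZero M] in
/-- The torus size of a lattice momentum is nonnegative. -/
theorem klband_klTorusNorm_nonneg (k : TorusSite 2 L) : 0 ≤ klTorusNorm L k := by
  unfold klTorusNorm
  exact KLProgrammeLegKernels.torusSupNorm_nonneg _

/-- `gainBar ≥ 0` for a well-formed `G` (both gains are nonnegative at every transfer). -/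
theorem klband_gainBar_nonneg (hG : G.WF) (P : SplitConsts) (U : ℝ) (n : ℕ) (ρpp ρd ρx : ℝ) :
    0 ≤ gainBar G P U n ρpp ρd ρx := by
  have hpp := hG.2.2.2.2.2.2.2.2.2.2.2.1
  have hph := hG.2.2.2.2.2.2.2.2.2.2.2.2.1
  unfold gainBar
  exact mul_nonneg (sq_nonneg _) (add_nonneg (add_nonneg (hpp _ _) (hph _ _)) (hph _ _))

/-- **(E2″-v7)_n from a sign-blind pair-increment bound inside `thermalBar`**: if on the ball, for every total momentum `Qm`,
`‖𝒞_n(Qm;k,k′) − 𝒞_{n−1}(Qm;k,k′)‖ ≤ thermalBar G P U β n`, then `PairValueIncrementAtV7 … n` (the other budget terms are `≥ 0`). -/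
theorem klband_pairValueIncrementAtV7_of_le_thermalBar (hG : G.WF) (hP : P.WF) (hQ : Q.WF)
    (h : ∀ Qm : TorusSite 2 L, ∀ k ∈ klBall L μ K, ∀ k' ∈ klBall L μ K,
      ‖klPairAmplitude L M β U μ K n Qm k k' - klPairAmplitude L M β U μ K (n - 1) Qm k k'‖ ≤ thermalBar G P U β n) :
    PairValueIncrementAtV7 L M G P Q β U μ K n := by
  intro _ Qm k hk k' hk'
  have hK : 0 ≤ P.Klam := zero_le_one.trans hP.1
  have hgain := klband_gainBar_nonneg hG P U n (klTorusNorm L Qm) (klTorusNorm L (k - k')) (klTorusNorm L (k + k' - Qm))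
  have herem := eremBar_nonneg' hG hP hQ U β L (n - 1)
  have hleg := legDressBarQ2_nonneg G hK hQ.2.1 U n (legSliceCountT L β μ K n ![k', Qm - k', Qm - k, k])
  linarith [h Qm k hk k' hk']

/-- **(E2′-S4)_n from a sign-blind coupling-increment bound inside `thermalBar`**: if on the ball
`‖λ_n^{↑↓}(k₁,k₂,k₃) − λ_{n−1}^{↑↓}(k₁,k₂,k₃)‖ ≤ thermalBar G P U β n`, then `QuarticValueIncrementAtS4 … n`. -/
theorem klband_quarticValueIncrementAtS4_of_le_thermalBar (hG : G.WF) (hP : P.WF) (hQ : Q.WF)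
    (h : ∀ k₁ ∈ klBall L μ K, ∀ k₂ ∈ klBall L μ K, ∀ k₃ ∈ klBall L μ K,
      ‖klQuarticValue L M β U μ K n 0 1 k₁ k₂ k₃ - klQuarticValue L M β U μ K (n - 1) 0 1 k₁ k₂ k₃‖ ≤ thermalBar G P U β n) :
    QuarticValueIncrementAtS4 L M G P Q β U μ K n := by
  intro _ k₁ hk₁ k₂ hk₂ k₃ hk₃
  have hK : 0 ≤ P.Klam := zero_le_one.trans hP.1
  have hgain := klband_gainBar_nonneg hG P U n (klTorusNorm L (k₁ + k₃)) (klTorusNorm L (k₁ - k₂)) (klTorusNorm L (k₂ - k₃))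
  have herem := eremBar_nonneg' hG hP hQ U β L (n - 1)
  have hleg := legDressBarQ2_nonneg G hK hQ.2.1 U n (legSliceCountT L β μ K n ![k₁, k₂, k₃, k₁ - k₂ + k₃])
  linarith [h k₁ hk₁ k₂ hk₂ k₃ hk₃]

/-- **(E2-v10)_n (`n ≥ 1`) from a sign-blind in-class pair-increment bound inside `thermalBar`**, with the TRIVIAL ladder witness
`w = 0`, `N = 1`: then `A·N = klPairArray … (n−1) Qm`, whose ball entries are `𝒞_{n−1}(Qm;k,k′)` (`klPairArray_apply_of_mem`), the weight
conditions read `0 ≤ bhi`, `0 ≤ 2·klEdge`, and the clause is the plain increment bound against a budget `≥ thermalBar`. -/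
theorem klband_pairLadderStepAtV10_of_le_thermalBar (hG : G.WF) (hP : P.WF) (hQ : Q.WF) (hn : 1 ≤ n)
    (h : ∀ Qm : TorusSite 2 L, IsPairClassAt L Qm n → ∀ k ∈ klBall L μ K, ∀ k' ∈ klBall L μ K,
      ‖klPairAmplitude L M β U μ K n Qm k k' - klPairAmplitude L M β U μ K (n - 1) Qm k k'‖ ≤ thermalBar G P U β n) :
    PairLadderStepAtV10 L M G P Q β U μ K n := by
  have hK : 0 ≤ P.Klam := zero_le_one.trans hP.1
  have hbhi : 0 ≤ G.bhi := hG.2.2.1.trans hG.2.2.2.1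
  have hph := hG.2.2.2.2.2.2.2.2.2.2.2.2.1
  refine ⟨fun h0 => absurd h0 (by omega), fun _ Qm hQm => ⟨fun _ => 0, ?_, ?_, 1, ?_, fun k hk k' hk' => ?_⟩⟩
  · simpa using hbhi
  · have := klEdge_nonneg hbhi n (klband_klTorusNorm_nonneg (L := L) Qm)
    simpa using mul_nonneg zero_le_two this
  · have h0 : (Matrix.diagonal fun _ : TorusSite 2 L => (((0 : ℝ) : ℝ) : ℂ)) = 0 := by
      rw [Complex.ofReal_zero]; exact Matrix.diagonal_zero
    rw [h0, Matrix.zero_mul, add_zero, Matrix.mul_one]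
  · rw [Matrix.mul_one, klPairArray_apply_of_mem L M β U μ K (n - 1) Qm hk hk']
    have hdrive : 0 ≤ drivePBar G P U (n - 1) := drivePBar_nonneg' hG U (n - 1)
    have herem := eremBar_nonneg' hG hP hQ U β L (n - 1)
    have hleg := legDressBarQ2_nonneg G hK hQ.2.1 U n (legSliceCountT L β μ K n ![k', Qm - k', Qm - k, k])
    have h1 := hph n (klTorusNorm L (k - k'))
    have h2 := hph n (klTorusNorm L (k + k' - Qm))
    have hsq : 0 ≤ (P.Klam * U) ^ 2 := sq_nonneg _
    have h3 : 0 ≤ (P.Klam * U) ^ 2 * (G.phGain n (klTorusNorm L (k - k')) + G.phGain n (klTorusNorm L (k + k' - Qm))) :=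
      mul_nonneg hsq (add_nonneg h1 h2)
    linarith [h Qm hQm k hk k' hk']

/-- **The three value clauses of the band at once** (`n ≥ 1`): sign-blind pair increments (all `Qm`) and `↑↓` coupling increments on the
ball, each `≤ thermalBar G P U β n`, give `(E2-v10)_n ∧ (E2″-v7)_n ∧ (E2′-S4)_n`. -/
theorem klband_valueClauses_of_le_thermalBar (hG : G.WF) (hP : P.WF) (hQ : Q.WF) (hn : 1 ≤ n)
    (hpair : ∀ Qm : TorusSite 2 L, ∀ k ∈ klBall L μ K, ∀ k' ∈ klBall L μ K,
      ‖klPairAmplitude L M β U μ K n Qm k k' - klPairAmplitude L M β U μ K (n - 1) Qm k k'‖ ≤ thermalBar G P U β n)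
    (hquart : ∀ k₁ ∈ klBall L μ K, ∀ k₂ ∈ klBall L μ K, ∀ k₃ ∈ klBall L μ K,
      ‖klQuarticValue L M β U μ K n 0 1 k₁ k₂ k₃ - klQuarticValue L M β U μ K (n - 1) 0 1 k₁ k₂ k₃‖ ≤ thermalBar G P U β n) :
    PairLadderStepAtV10 L M G P Q β U μ K n ∧ PairValueIncrementAtV7 L M G P Q β U μ K n ∧
      QuarticValueIncrementAtS4 L M G P Q β U μ K n :=
  ⟨klband_pairLadderStepAtV10_of_le_thermalBar hG hP hQ hn fun Qm _ k hk k' hk' => hpair Qm k hk k' hk',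
    klband_pairValueIncrementAtV7_of_le_thermalBar hG hP hQ hpair, klband_quarticValueIncrementAtS4_of_le_thermalBar hG hP hQ hquart⟩

end Model

/-! ## §3 The reading at the package of record `klEngGeo5` (`CF ≥ 2^80`) -/

/-- **Band reading at `klEngGeo5`**: `X ≤ C·(Klam U)²`, `0 ≤ C`, `C·4^T ≤ 2^80`, `n_β ≤ n + T` ⇒ `X ≤ thermalBar klEngGeo5 P U β n`. -/
theorem klg5_band_le_thermalBar {P : SplitConsts} {U β X C : ℝ} {n T : ℕ} (hC : 0 ≤ C) (hCT : C * 4 ^ T ≤ 2 ^ 80)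
    (hband : nScales β ≤ n + T) (hX : X ≤ C * (P.Klam * U) ^ 2) : X ≤ thermalBar klEngGeo5 P U β n :=
  klband_le_thermalBar hC (hCT.trans two_pow_le_klEngGeo5_CF) hband hX

/-- The widest band the `2^80` floor certifies for a unit constant: `C ≤ 2^10` and `T ≤ 35` give `C·4^T ≤ 2^80`. -/
theorem klg5_band_const_le {C : ℝ} (hC : C ≤ 2 ^ 10) {T : ℕ} (hT : T ≤ 35) : C * 4 ^ T ≤ 2 ^ 80 := by
  have h4 : (4 : ℝ) ^ T ≤ 4 ^ 35 := pow_le_pow_right₀ (by norm_num) hT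
  have h4' : (0 : ℝ) ≤ 4 ^ T := by positivity
  calc C * 4 ^ T ≤ 2 ^ 10 * 4 ^ 35 := mul_le_mul hC h4 h4' (by positivity)
    _ = 2 ^ 80 := by norm_num

section Model

variable {L M : ℕ} [NeZero L] [NeZero M] {P : SplitConsts} {Q : EngConsts} {β U μ : ℝ} {K : TrigPolyC4v} {n T : ℕ} {Cp Cq : ℝ}

/-- **The value conjuncts of `stub_engine_step_values` in the thermal band, from SIGN-BLIND bounds** (package `klEngGeo5`, any well-formed `Q`,
e.g. `klEngQ5 P R` by `klEngQ5_wf`): for `1 ≤ n`, `nScales β ≤ n + T`, sign-blind increment bounds `‖𝒞_n − 𝒞_{n−1}‖ ≤ Cp·(Klam U)²` (every `Qm`,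
ball × ball) and `‖λ_n^{↑↓} − λ_{n−1}^{↑↓}‖ ≤ Cq·(Klam U)²` (ball³) with `Cp·4^T ≤ 2^80`, `Cq·4^T ≤ 2^80`, together with (E4)_n and (E5-S)_n, give the
stub's literal conclusion `PairLadderStepAtV10 ∧ PairValueIncrementAtV7 ∧ QuarticValueIncrementAtS4 ∧ EngineFirstMoments ∧ IsoTupleL1AtS` at `n`. -/
theorem klg5_band_stepValues_of_signBlind (hP : P.WF) (hQ : Q.WF) (hn : 1 ≤ n) (hband : nScales β ≤ n + T)
    (hCp : 0 ≤ Cp) (hCpT : Cp * 4 ^ T ≤ 2 ^ 80) (hCq : 0 ≤ Cq) (hCqT : Cq * 4 ^ T ≤ 2 ^ 80)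
    (hpair : ∀ Qm : TorusSite 2 L, ∀ k ∈ klBall L μ K, ∀ k' ∈ klBall L μ K,
      ‖klPairAmplitude L M β U μ K n Qm k k' - klPairAmplitude L M β U μ K (n - 1) Qm k k'‖ ≤ Cp * (P.Klam * U) ^ 2)
    (hquart : ∀ k₁ ∈ klBall L μ K, ∀ k₂ ∈ klBall L μ K, ∀ k₃ ∈ klBall L μ K,
      ‖klQuarticValue L M β U μ K n 0 1 k₁ k₂ k₃ - klQuarticValue L M β U μ K (n - 1) 0 1 k₁ k₂ k₃‖ ≤ Cq * (P.Klam * U) ^ 2)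
    (hE4 : EngineFirstMoments L M klEngGeo5 P Q β U μ K n) (hE5 : IsoTupleL1AtS L M klEngGeo5 P β U μ K n) :
    PairLadderStepAtV10 L M klEngGeo5 P Q β U μ K n ∧ PairValueIncrementAtV7 L M klEngGeo5 P Q β U μ K n ∧
      QuarticValueIncrementAtS4 L M klEngGeo5 P Q β U μ K n ∧ EngineFirstMoments L M klEngGeo5 P Q β U μ K n ∧
        IsoTupleL1AtS L M klEngGeo5 P β U μ K n := by
  have h3 := klband_valueClauses_of_le_thermalBar (G := klEngGeo5) klEngGeo5_wf hP hQ hn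
    (fun Qm k hk k' hk' => klg5_band_le_thermalBar hCp hCpT hband (hpair Qm k hk k' hk'))
    (fun k₁ hk₁ k₂ hk₂ k₃ hk₃ => klg5_band_le_thermalBar hCq hCqT hband (hquart k₁ hk₁ k₂ hk₂ k₃ hk₃))
  exact ⟨h3.1, h3.2.1, h3.2.2, hE4, hE5⟩

/-- The same at and beyond the last scale (`nScales β ≤ n`, so in particular at `n = nScales β + 1`), with `Cp, Cq ≤ 2^80`. -/
theorem klg5_lastScales_stepValues_of_signBlind (hP : P.WF) (hQ : Q.WF) (hn : 1 ≤ n) (hlast : nScales β ≤ n)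
    (hCp : 0 ≤ Cp) (hCp' : Cp ≤ 2 ^ 80) (hCq : 0 ≤ Cq) (hCq' : Cq ≤ 2 ^ 80)
    (hpair : ∀ Qm : TorusSite 2 L, ∀ k ∈ klBall L μ K, ∀ k' ∈ klBall L μ K,
      ‖klPairAmplitude L M β U μ K n Qm k k' - klPairAmplitude L M β U μ K (n - 1) Qm k k'‖ ≤ Cp * (P.Klam * U) ^ 2)
    (hquart : ∀ k₁ ∈ klBall L μ K, ∀ k₂ ∈ klBall L μ K, ∀ k₃ ∈ klBall L μ K,
      ‖klQuarticValue L M β U μ K n 0 1 k₁ k₂ k₃ - klQuarticValue L M β U μ K (n - 1) 0 1 k₁ k₂ k₃‖ ≤ Cq * (P.Klam * U) ^ 2)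
    (hE4 : EngineFirstMoments L M klEngGeo5 P Q β U μ K n) (hE5 : IsoTupleL1AtS L M klEngGeo5 P β U μ K n) :
    PairLadderStepAtV10 L M klEngGeo5 P Q β U μ K n ∧ PairValueIncrementAtV7 L M klEngGeo5 P Q β U μ K n ∧
      QuarticValueIncrementAtS4 L M klEngGeo5 P Q β U μ K n ∧ EngineFirstMoments L M klEngGeo5 P Q β U μ K n ∧
        IsoTupleL1AtS L M klEngGeo5 P β U μ K n :=
  klg5_band_stepValues_of_signBlind (T := 0) hP hQ hn (by simpa using hlast) hCp (by simpa using hCp') hCq (by simpa using hCq')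
    hpair hquart hE4 hE5

end Model

end Summit.HubbardSuperconductivity.HubbardSuperconductivity.Theorems.EngineV8

end
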